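import Mathlib
import Summits.ValiantsHypothesis.ValiantsHypothesis.Theorems.TwistedDetRankTdrSuperadditive

/-!
# Crux `TwistedDetRank.TdrPerNotQP` (stmt-ValiantsHypothesis-6284), line `registered` —
# registered stub `stub_coneRestriction`: YOUNG-SUBGROUP RESTRICTION IN COEFFICIENT SPACE

**Claim settled.** A representation of the generic permanent `per_{m·k}` as a sum of `r`
Hadamard-twisted determinants `det (E_t ∘ X)` (`E_t ∈ ℂ^{mk × mk}`, `t < r`) yields a length-`r`
decomposition of the `m`-th tensor power of `sgn_k` into products of Birkhoff-cone points: there are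
matrices `u t b ∈ ℂ^{k×k}` (`t < r`, `b < m`) with
`∑_t ∏_b ∏_i u t b (π_b i) i = ∏_b sgn π_b` for every block permutation `π ∈ 𝔖_k^m`.

**Proof** (the `m`-fold, size-`k` analogue of the landed two-block lemma
`TwistedDetRankTdrSuperadditive.sign_mul_sign_eq_of_rep`).  Comparing coefficients of the permutation
monomials, the representation is the identity `sgn σ = ∑_t ∏_i E_t (σ i) i` on `𝔖_{mk}`
(`TwistedDetRankTdrSuperadditive.perPoly_eq_sum_twistedDet_iff`, landed).  Evaluate it at the block
permutation `σ_π := finProdFinEquiv.permCongr (Equiv.prodCongrRight π)` of `π : Fin m → 𝔖_k`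
(`finProdFinEquiv : Fin m × Fin k ≃ Fin (m·k)`): its sign is `∏_b sgn π_b`
(`Equiv.Perm.sign_permCongr`, `Equiv.Perm.sign_prodCongrRight`), and the product over `Fin (m·k)`
splits along `finProdFinEquiv` into the `m` diagonal `k × k` blocks
`u t b i' i := E_t (finProdFinEquiv (b, i')) (finProdFinEquiv (b, i))` of `E_t`
(`Equiv.prod_comp`, `Fintype.prod_prod_type`).  The degenerate cases `k = 0` or `m = 0` need no
special treatment.
-/

-- `Summit.<Summit>.<Problem>` repeats `ValiantsHypothesis` by the tree's layout convention (D-0017).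
set_option linter.dupNamespace false

namespace Summit.ValiantsHypothesis.ValiantsHypothesis.Theorems.TwistedDetRankTdrPerNotQP

open Literature.Computability.AlgebraicComplexity MvPolynomial Finset
open Summit.ValiantsHypothesis.ValiantsHypothesis.Theorems.TwistedDetRankTdrSuperadditive

/-- The sign of the block permutation `σ_π = finProdFinEquiv.permCongr (prodCongrRight π)` of
`π : Fin m → 𝔖_k` is `∏_b sgn π_b` (cast to `ℂ`). -/
theorem coneRestriction_sign_blockPerm {k m : ℕ} (π : Fin m → Equiv.Perm (Fin k)) :
    ((Equiv.Perm.sign (finProdFinEquiv.permCongr (Equiv.prodCongrRight π)) : ℤ) : ℂ) =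
      ∏ b, ((Equiv.Perm.sign (π b) : ℤ) : ℂ) := by
  rw [Equiv.Perm.sign_permCongr, Equiv.Perm.sign_prodCongrRight, Units.coe_prod, Int.cast_prod]

/-- The cone coordinate `∏_i F (σ_π i) i` of a matrix `F ∈ ℂ^{mk × mk}` at the block permutation
`σ_π` splits along `finProdFinEquiv` into the product over the blocks `b < m` of the cone
coordinates of the diagonal `k × k` blocks of `F` at `π_b`. -/
theorem coneRestriction_prod_blockPerm {k m : ℕ} (F : Matrix (Fin (m * k)) (Fin (m * k)) ℂ)
    (π : Fin m → Equiv.Perm (Fin k)) :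
    ∏ i, F ((finProdFinEquiv.permCongr (Equiv.prodCongrRight π)) i) i =
      ∏ b, ∏ i, F (finProdFinEquiv (b, π b i)) (finProdFinEquiv (b, i)) := by
  rw [← finProdFinEquiv.prod_comp, Fintype.prod_prod_type]
  simp only [Equiv.permCongr_apply, Equiv.symm_apply_apply, Equiv.prodCongrRight_apply]

/-- **Registered stub `stub_coneRestriction`** (Young-subgroup restriction in coefficient space).
A representation `per_{m·k} = ∑_{t<r} det (E_t ∘ X)` yields matrices `u t b ∈ ℂ^{k×k}` (the diagonal
`k × k` blocks of `E_t` along `finProdFinEquiv`) with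
`∑_t ∏_b ∏_i u t b (π_b i) i = ∏_b sgn π_b` for every `π : Fin m → 𝔖_k`. -/
theorem stub_coneRestriction :
    ∀ (k m r : ℕ) (E : Fin r → Matrix (Fin (m * k)) (Fin (m * k)) ℂ),
      Literature.Computability.AlgebraicComplexity.perPoly (Fin (m * k)) ℂ =
          ∑ t, (Matrix.of fun i j => MvPolynomial.C (E t i j) * MvPolynomial.X (i, j)).det →
      ∃ u : Fin r → Fin m → Matrix (Fin k) (Fin k) ℂ,
        ∀ π : Fin m → Equiv.Perm (Fin k),
          ∑ t, ∏ b, ∏ i, u t b (π b i) i = ∏ b, ((Equiv.Perm.sign (π b) : ℤ) : ℂ) := by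
  intro k m r E hE
  have hcoef := (perPoly_eq_sum_twistedDet_iff E).1 hE
  refine ⟨fun t b i' i => E t (finProdFinEquiv (b, i')) (finProdFinEquiv (b, i)), fun π => ?_⟩
  rw [← coneRestriction_sign_blockPerm π, hcoef (finProdFinEquiv.permCongr (Equiv.prodCongrRight π))]
  exact Finset.sum_congr rfl fun t _ => (coneRestriction_prod_blockPerm (E t) π).symm

end Summit.ValiantsHypothesis.ValiantsHypothesis.Theorems.TwistedDetRankTdrPerNotQP
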